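import Mathlib
import HarnessLib
import Literature.ComputerArithmetic.BrisebarreHanrotMullerZimmermann2025.TableMakersDilemma
import Literature.ComputerArithmetic.Lefevre2005.SubdomainCertificate

/-!
# Hanrot–Lefèvre–Stehlé–Zimmermann: worst cases of a periodic function for large arguments

G. Hanrot, V. Lefèvre, D. Stehlé, P. Zimmermann, *Worst Cases of a Periodic Function for Large Arguments*,
18th IEEE Symposium on Computer Arithmetic (ARITH-18), 2007, pp. 133–140 = INRIA Research Report RR-6106
(2007) [HanrotEtAl2007]. This is the argument behind every hardest-to-round search for `sin`, `cos`, `tan` on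
the binary64 binades `[2^(e−1), 2^e)` with `e` large (Lefèvre–Ly–Zimmermann, ARITH 2026, computed the complete
binary64 lists this way): for such binades "even if `x` and `x′` are two consecutive floating-point numbers, the
values `f(x)` and `f(x′)` can be completely different" (§1), so the classical sub-interval + polynomial
approximation searches (Lefèvre, SLZ) do not apply directly. The remedy (§4.1, Figure 2): "consider an integer `q`
such that `τ := qμ cmod Π` is small … Each `t ∈ ⟦t₀, t₀ + N⟧` can be uniquely written `t = sq + r`, where
`0 ⩽ r < q`. Then `μt` in Equation (1) becomes `τs + μr mod Π`, and thus Equation (1) is now: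
`|λ · g_r(τs) cmod 1| ⩽ ε` … where `g_r(x) := f(rμ + x)`. We have thus transformed one problem for the function
`f` with parameters `λ, μ, t₀, N` into `q` similar problems for the functions `g_r`, `0 ⩽ r < q`, with parameters
`λ, τ, (t₀ − r)/q, N/q`." Along each arithmetic progression `A(q, r)` the reduced arguments `rμ + τs` ARE in a
(real) arithmetic progression of tiny step `τ`, so "we are thus back to the classical case, where Lefèvre's or
the SLZ algorithms apply. One difference is that the distance between two consecutive numbers to check is `τ`
which is irrational instead of `2^(e−p)`, but this makes no difference for Lefèvre's algorithm or SLZ" (§4.1).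

## Contents (everything PROVED; 0 named facts)

* §1 Notation: `cmod x y` ("a representative of `x + ℤy` which lies in `[−y/2, y/2]`"), `abs_cmod_le`,
  `abs_cmod_le_abs_sub_int_mul`; §2 Definition 2 / §3 Equation (1): `EqOne f lam μ ε t :↔ |λ·f(μt) cmod 1| ⩽ ε`
  (written `∃ n : ℤ, |λ·f(μt) − n| ⩽ ε`, `eqOne_iff_cmod`), and its reading in the Table-Maker's-Dilemma
  vocabulary of the tree ([BrisebarreEtAl2025] Problems 4.1/4.2, `Literature…BrisebarreHanrotMullerZimmermann2025`):
  with `λ = 2^(p−h)`, `μ = 2^(e−p)` (§3: "we have λ = 2^(p−h), μ = 2^(e−p), t₀ = N = 2^(p−1)") the quantity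
  `λ·f(μt)` IS `scaled f p (e−1) (h−1) t` (`scaled_eq_lam_mul`), and `IsBadCaseDir m` is `EqOne` with the strict
  bound `2^(−m)` (`isBadCaseDir_iff_abs_cmod_lt`, `IsBadCaseDir.eqOne`).
* §2, the sentence after Definition 2: "any `ε`-bad case for the rounding to nearest mode in precision `p` is a
  `(2ε)`-bad case in precision `p + 1` for directed rounding" (`exists_abs_two_mul_sub_int_le`, and in tree
  vocabulary `scaled_succ_prec`, `isBadCaseDir_succ_prec_of_isBadCaseRN`).
* **§4.1 THE REDUCTION** (`apply_mul_eq_gFun`: for `f` of period `Π` and `τ = qμ − ℓΠ`,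
  `f(μ(sq + r)) = g_r(τs)`; `eqOne_iff_eqOne_gFun`: `t = sq + r` solves Equation (1) for `(f, λ, μ)` iff `s`
  solves it for `(g_r, λ, τ)`; `exists_eq_mul_add_of_pos` / `mul_add_mem_Icc_iff`: the unique writing
  `t = sq + r` and the range `s ∈ ⟦⌈(t₀ − r)/q⌉, ⌊(t₀ + N − r)/q⌋⟧`; **`solutions_eq_biUnion`**: the solution
  set of Equation (1) on `⟦t₀, t₀+N⟧` is the union over `r < q` of the images `s ↦ sq + r` of the solution sets
  of the `q` reduced problems — i.e. the completeness of the main algorithm, Figure 3, GIVEN a complete solver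
  for each progression (Theorem 1's "finds all the values" clause; the solver's own completeness is SLZ's,
  `Literature…StehleLefevreZimmermann2005.ISValP`, or Lefèvre's, `Literature…Lefevre2005`);
  `forall_Icc_of_forall_progression` (the converse bookkeeping: per-progression certificates for every `r < q`
  give the statement for every `t ∈ ⟦t₀, t₀ + N⟧`); `sub_le_ediv_of_mem_progression`: each progression meets `⟦t₀, t₀+N⟧` in an index interval of length
  `⩽ ⌊N/q⌋` (§6.1: "each arithmetic progression `sq + r` for a given `r` has at most 298116 elements in the
  range `[2^52, 2^53)`" for `q = 15106909301` — `example` below).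
* The same in the tree's TMD vocabulary: **`scaled_mul_add`** (`scaled f p e₁ e₂ (s·q + r) =
  2^(p−1−e₂)·f(r·2^(e₁−p+1) + τ·s)`), and the Lefèvre-route piece certificates ALONG A PROGRESSION
  (§4.1/§5: "These equations can be solved by using Lefèvre's algorithm or the SLZ algorithm"):
  **`not_isBadCaseDir_progression_of_algorithm1`** / `…RN…` / `…_rat` — literally
  `Lefevre2005.not_isBadCaseDir_of_algorithm1` with the piece `X₀ + k` replaced by the sub-progression
  `(s₀ + k)·q + r` and the scaled function replaced by `k ↦ 2^(p−1−e₂)·f(rμ + τ(s₀ + k))`; and the approximation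
  hypothesis from a second-derivative bound along the progression, `approx_progression_of_second_deriv_bound`
  (error `2^(p−1−e₂)·τ²·M·N²/2`: the paper's "with an error of the order of `(τs)^(d+1)`" for `d = 1`), with the
  `sin`/`cos` instances `approx_progression_sin` / `approx_progression_cos` (`M = 1`).
* §4.3 (output exponents): "it suffices to check that `sin x₀` and `sin(x₀ + h)` lie in the same binade … Around
  the points `−π/2` and `π/2` … one has `1/2 ⩽ |sin x| ⩽ 1` in an interval of width `2π/3 > h`":
  `mem_Ico_of_monotoneOn` (constant binade from two end values on a monotonicity interval),
  `half_le_sin_of_mem_Icc` (`1/2 ⩽ sin x` on `[π/6, 5π/6]`), `abs_sin_ratCast_lt_one` (a floating-point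
  argument never reaches `|sin x| = 1`, so the top binade is `[1/2, 1)`).
* §5, first paragraph: "by the classical Dirichlet theorem, for any `Q` one can find `0 ⩽ q ⩽ Q` such that the
  corresponding `τ` has `|τ| ⩽ Π/Q`" — `exists_mul_sub_int_mul_le` (from Mathlib's
  `Real.exists_int_int_abs_mul_sub_le`, bound `Π/(Q+1)`, `1 ⩽ q ⩽ Q`).

## What is NOT here (and why)

* Theorem 1's running-time clause and Theorem 2 / §5 (the `2^(0.676p)` heuristic complexity, the table of optimal
  `(Q, ε, T)` per degree `d`): heuristic statements ("the complexity statement of the theorem above is only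
  heuristic", §3), not propositions we can state honestly — quoted in `HOME/TMD-PRINT.md`.
* §4.2 Lemma 1 / Figure 4 (working precision `3p + O(1)` after an `e + 3p`-bit precomputation of `qμ cmod Π`):
  an error analysis of one floating-point procedure for APPROXIMATING `τ`. Here `τ = qμ − ℓΠ` is the exact real
  number; a certificate's rational stand-ins for `f(rμ + τs₀)` and `τ·f′(…)` enter only through the tolerances
  `η₀, η₁` of `approx_progression_of_second_deriv_bound`, so no working-precision lemma is needed on this side.
* The choice of `q` as a continued-fraction convergent denominator (Figure 3, Step 1) is an efficiency matter;
  every `q ⩾ 1` and every integer `ℓ` give a valid reduction (the identities below hold for any `τ = qμ − ℓΠ`).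
* §6 (the two bad cases of `sin` on `[2^1023, 2^1024)` with 43 resp. 45 identical bits, the exponent census of
  the 15106909301 progressions): data; certifying them needs a ≈1100-bit enclosure of `π` (Summits side).
-/

namespace Literature.ComputerArithmetic.HanrotLefevreStehleZimmermann2007

open Literature.ComputerArithmetic.BrisebarreHanrotMullerZimmermann2025
open Literature.ComputerArithmetic.Lefevre2005
open Set

/-! ## §1 Notation: `x cmod y` -/

/-- `x cmod y`: "a representative of `x + ℤy` which lies in `[−y/2, y/2]`, i.e., the difference between `x` and
the closest multiple of `y`, taking whatever choice if `x` is exactly the middle of two consecutive multiples of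
`y`" — we take the multiple `round (x / y) · y`. [cite: HanrotEtAl2007, §1 Notation] -/
noncomputable def cmod (x y : ℝ) : ℝ := x - round (x / y) * y

/-- `cmod` unfolds as stated. [cite: HanrotEtAl2007, §1 Notation] -/
theorem cmod_def (x y : ℝ) : cmod x y = x - round (x / y) * y := rfl

/-- `x cmod y ∈ x + ℤy`. [cite: HanrotEtAl2007, §1 Notation] -/
theorem exists_int_cmod_eq (x y : ℝ) : ∃ n : ℤ, cmod x y = x - n * y := ⟨round (x / y), rfl⟩

/-- `x cmod 1 = x − round x`. [cite: HanrotEtAl2007, §1 Notation] -/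
theorem cmod_one (x : ℝ) : cmod x 1 = x - round x := by simp [cmod]

/-- `|x cmod y| ⩽ |y|/2` ("lies in `[−y/2, y/2]`"). [cite: HanrotEtAl2007, §1 Notation] -/
theorem abs_cmod_le (x : ℝ) {y : ℝ} (hy : y ≠ 0) : |cmod x y| ≤ |y| / 2 := by
  have h : cmod x y = (x / y - round (x / y)) * y := by rw [cmod_def, sub_mul, div_mul_cancel₀ _ hy]
  rw [h, abs_mul]
  have := abs_sub_round (x / y)
  nlinarith [abs_nonneg y]

/-- `x cmod y` is the difference between `x` and the CLOSEST multiple of `y`: `|x cmod y| ⩽ |x − n·y|` for every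
integer `n`. [cite: HanrotEtAl2007, §1 Notation] -/
theorem abs_cmod_le_abs_sub_int_mul (x : ℝ) {y : ℝ} (hy : y ≠ 0) (n : ℤ) : |cmod x y| ≤ |x - n * y| := by
  have h : cmod x y = (x / y - round (x / y)) * y := by rw [cmod_def, sub_mul, div_mul_cancel₀ _ hy]
  have h' : x - n * y = (x / y - n) * y := by rw [sub_mul, div_mul_cancel₀ _ hy]
  rw [h, h', abs_mul, abs_mul]
  exact mul_le_mul_of_nonneg_right (round_le (x / y) n) (abs_nonneg y)

/-- `|x cmod 1| ⩽ ε` iff `x` is within `ε` of SOME integer. [cite: HanrotEtAl2007, §1 Notation and Definition 2] -/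
theorem abs_cmod_one_le_iff {x ε : ℝ} : |cmod x 1| ≤ ε ↔ ∃ n : ℤ, |x - n| ≤ ε := by
  constructor
  · intro h; exact ⟨round x, by simpa [cmod_one] using h⟩
  · rintro ⟨n, hn⟩
    have h := abs_cmod_le_abs_sub_int_mul x one_ne_zero n
    rw [mul_one] at h
    exact h.trans hn

/-- `|x cmod 1| < ε` iff `x` is within `< ε` of some integer. [cite: HanrotEtAl2007, §1 Notation and Definition 2] -/
theorem abs_cmod_one_lt_iff {x ε : ℝ} : |cmod x 1| < ε ↔ ∃ n : ℤ, |x - n| < ε := by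
  constructor
  · intro h; exact ⟨round x, by simpa [cmod_one] using h⟩
  · rintro ⟨n, hn⟩
    have h := abs_cmod_le_abs_sub_int_mul x one_ne_zero n
    rw [mul_one] at h
    exact h.trans_lt hn

/-- The tree's `m`-bad cases ([BrisebarreEtAl2025] §4.4) in the paper's notation: `IsBadCaseDir m y` iff
`|y cmod 1| < 2^(−m)`. [cite: HanrotEtAl2007, Definition 2; BrisebarreEtAl2025, §4.4] -/
theorem isBadCaseDir_iff_abs_cmod_lt (m : ℕ) (y : ℝ) :
    IsBadCaseDir m y ↔ |cmod y 1| < (2 : ℝ) ^ (-(m : ℤ)) := by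
  rw [abs_cmod_one_lt_iff]; rfl

/-! ## §2 Definition 2 and §3 Equation (1) -/

/-- **Equation (1)** [cite: HanrotEtAl2007, §3 eq. (1) and Definition 2]: "`|λ · f(μt) cmod 1| ⩽ ε` with
`t ∈ ⟦t₀, t₀ + N⟧`, where `λ, μ`, and `ε` are positive real numbers and `t₀, N ∈ ℤ`" — the predicate on `t`,
written `∃ n : ℤ, |λ·f(μt) − n| ⩽ ε` (`eqOne_iff_cmod`). With `λ = 2^p / 2^Exp(f x)` this is Definition 2
("an `ε`-bad case … `|2^p · m(f(x)) cmod 1| ⩽ ε`"): `f(x)` is at distance `⩽ ε` ulp from a precision-`p` number,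
"bad cases for the directed rounding modes". -/
def EqOne (f : ℝ → ℝ) (lam μ ε : ℝ) (t : ℤ) : Prop := ∃ n : ℤ, |lam * f (μ * t) - n| ≤ ε

/-- `EqOne` is the printed `|λ · f(μt) cmod 1| ⩽ ε`. [cite: HanrotEtAl2007, §3 eq. (1)] -/
theorem eqOne_iff_cmod (f : ℝ → ℝ) (lam μ ε : ℝ) (t : ℤ) :
    EqOne f lam μ ε t ↔ |cmod (lam * f (μ * t)) 1| ≤ ε := (abs_cmod_one_le_iff).symm

/-- The solution set of Equation (1): "All the solutions `t ∈ ⟦t₀, t₀ + N⟧` to Equation (1)" (the specified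
output of Figures 1 and 3). [cite: HanrotEtAl2007, §3 eq. (1), Figure 1, Figure 3] -/
def solutions (f : ℝ → ℝ) (lam μ ε : ℝ) (t₀ N : ℤ) : Set ℤ :=
  {t : ℤ | t₀ ≤ t ∧ t ≤ t₀ + N ∧ EqOne f lam μ ε t}

/-- Membership in `solutions` unfolds as stated. [cite: HanrotEtAl2007, §3 eq. (1)] -/
theorem mem_solutions_iff {f : ℝ → ℝ} {lam μ ε : ℝ} {t₀ N t : ℤ} :
    t ∈ solutions f lam μ ε t₀ N ↔ t₀ ≤ t ∧ t ≤ t₀ + N ∧ EqOne f lam μ ε t := Iff.rfl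

/-- §3, the classical instance: "if we consider the restriction of `f` over the input interval `[2^(e−1), 2^e)`,
and assuming all outputs are in `[2^(h−1), 2^h)`, we have `λ = 2^(p−h)`, `μ = 2^(e−p)`" — then `λ·f(μt)` is the
tree's scaled value `scaled f p e₁ e₂ t` with `e₁ = e − 1`, `e₂ = h − 1` ([BrisebarreEtAl2025] Problem 4.1).
[cite: HanrotEtAl2007, §3; BrisebarreEtAl2025, Problem 4.1] -/
theorem scaled_eq_lam_mul (f : ℝ → ℝ) (p : ℕ) (e₁ e₂ t : ℤ) :
    scaled f p e₁ e₂ t = (2 : ℝ) ^ ((p : ℤ) - 1 - e₂) * f ((2 : ℝ) ^ (e₁ - (p : ℤ) + 1) * t) := by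
  rw [scaled_def, mul_comm ((t : ℤ) : ℝ)]

/-- An `m`-bad case of the tree ([BrisebarreEtAl2025] §4.4, strict bound `2^(−m)`) solves Equation (1) with
`ε = 2^(−m)` for the classical parameters `λ = 2^(p−1−e₂)`, `μ = 2^(e₁−p+1)`.
[cite: HanrotEtAl2007, Definition 2 and §3 eq. (1); BrisebarreEtAl2025, §4.4] -/
theorem _root_.Literature.ComputerArithmetic.BrisebarreHanrotMullerZimmermann2025.IsBadCaseDir.eqOne
    {f : ℝ → ℝ} {p m : ℕ} {e₁ e₂ t : ℤ} (h : IsBadCaseDir m (scaled f p e₁ e₂ t)) :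
    EqOne f ((2 : ℝ) ^ ((p : ℤ) - 1 - e₂)) ((2 : ℝ) ^ (e₁ - (p : ℤ) + 1)) ((2 : ℝ) ^ (-(m : ℤ))) t := by
  obtain ⟨n, hn⟩ := h
  exact ⟨n, by rw [← scaled_eq_lam_mul]; exact hn.le⟩

/-- Conversely a solution of Equation (1) with `ε < 2^(−m)` (classical parameters) is an `m`-bad case.
[cite: HanrotEtAl2007, Definition 2 and §3 eq. (1); BrisebarreEtAl2025, §4.4] -/
theorem EqOne.isBadCaseDir {f : ℝ → ℝ} {p m : ℕ} {e₁ e₂ t : ℤ} {ε : ℝ}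
    (h : EqOne f ((2 : ℝ) ^ ((p : ℤ) - 1 - e₂)) ((2 : ℝ) ^ (e₁ - (p : ℤ) + 1)) ε t)
    (hε : ε < (2 : ℝ) ^ (-(m : ℤ))) : IsBadCaseDir m (scaled f p e₁ e₂ t) := by
  obtain ⟨n, hn⟩ := h
  exact ⟨n, by rw [scaled_eq_lam_mul]; exact hn.trans_lt hε⟩

/-! ## §2: rounding to nearest in precision `p` ⟶ directed rounding in precision `p + 1` -/

/-- "any `ε`-bad case for the rounding to nearest mode in precision `p` is a `(2ε)`-bad case in precision `p + 1`
for directed rounding": if `y` is within `ε` of a half-integer then `2y` is within `2ε` of an integer.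
[cite: HanrotEtAl2007, §2 (after Definition 2)] -/
theorem exists_abs_two_mul_sub_int_le {y ε : ℝ} (h : ∃ k : ℤ, |y - (k + 1 / 2)| ≤ ε) :
    ∃ n : ℤ, |2 * y - n| ≤ 2 * ε := by
  obtain ⟨k, hk⟩ := h
  refine ⟨2 * k + 1, ?_⟩
  rw [show (2 : ℝ) * y - ((2 * k + 1 : ℤ) : ℝ) = 2 * (y - (k + 1 / 2)) by push_cast; ring, abs_mul, abs_two]
  linarith

/-- Passing from precision `p` to `p + 1` doubles the scaled value (the same argument `x = X·2^(e₁−p+1) =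
(2X)·2^(e₁−(p+1)+1)` has significand `2X` in precision `p + 1`). [cite: HanrotEtAl2007, §2 (after Definition 2);
BrisebarreEtAl2025, Problem 4.1] -/
theorem scaled_succ_prec (f : ℝ → ℝ) (p : ℕ) (e₁ e₂ X : ℤ) :
    scaled f (p + 1) e₁ e₂ (2 * X) = 2 * scaled f p e₁ e₂ X := by
  rw [scaled_def, scaled_def]
  have h2 : (2 : ℝ) ≠ 0 := by norm_num
  have harg : ((2 * X : ℤ) : ℝ) * (2 : ℝ) ^ (e₁ - ((p + 1 : ℕ) : ℤ) + 1) = (X : ℝ) * (2 : ℝ) ^ (e₁ - (p : ℤ) + 1) := by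
    push_cast
    rw [show e₁ - ((p : ℤ) + 1) + 1 = (e₁ - (p : ℤ) + 1) + (-1 : ℤ) by ring, zpow_add₀ h2]
    simp; ring
  have hpow : (2 : ℝ) ^ (((p + 1 : ℕ) : ℤ) - 1 - e₂) = 2 * (2 : ℝ) ^ ((p : ℤ) - 1 - e₂) := by
    push_cast
    rw [show (p : ℤ) + 1 - 1 - e₂ = ((p : ℤ) - 1 - e₂) + 1 by ring, zpow_add_one₀ h2, mul_comm]
  rw [harg, hpow, mul_assoc]

/-- In tree vocabulary: an `(m+1)`-bad case for rounding to nearest in precision `p` is an `m`-bad case for the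
directed roundings in precision `p + 1` (significand `2X`).
[cite: HanrotEtAl2007, §2 (after Definition 2); BrisebarreEtAl2025, §4.4] -/
theorem isBadCaseDir_succ_prec_of_isBadCaseRN {f : ℝ → ℝ} {p m : ℕ} {e₁ e₂ X : ℤ}
    (h : IsBadCaseRN (m + 1) (scaled f p e₁ e₂ X)) : IsBadCaseDir m (scaled f (p + 1) e₁ e₂ (2 * X)) := by
  obtain ⟨k, hk⟩ := h
  refine ⟨2 * k + 1, ?_⟩
  rw [scaled_succ_prec,
    show (2 : ℝ) * scaled f p e₁ e₂ X - ((2 * k + 1 : ℤ) : ℝ) = 2 * (scaled f p e₁ e₂ X - (k + 1 / 2)) by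
      push_cast; ring,
    abs_mul, abs_two]
  have e : (2 : ℝ) * (2 : ℝ) ^ (-((m + 1 : ℕ) : ℤ)) = (2 : ℝ) ^ (-(m : ℤ)) := by
    rw [show (-((m + 1 : ℕ) : ℤ)) = -(m : ℤ) - 1 by push_cast; ring, zpow_sub_one₀ (by norm_num : (2 : ℝ) ≠ 0)]
    ring
  calc 2 * |scaled f p e₁ e₂ X - (↑k + 1 / 2)| < 2 * (2 : ℝ) ^ (-((m + 1 : ℕ) : ℤ)) := by linarith
    _ = (2 : ℝ) ^ (-(m : ℤ)) := e

/-! ## §4.1 The reduction to arithmetic progressions -/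

section Reduction

variable {f : ℝ → ℝ} {P μ τ : ℝ} {q : ℕ} {ℓ : ℤ}

/-- The reduced function of the progression `r mod q`: "`g_r(x) := f(rμ + x)`". [cite: HanrotEtAl2007, §4.1] -/
def gFun (f : ℝ → ℝ) (μ : ℝ) (r : ℤ) (x : ℝ) : ℝ := f (r * μ + x)

/-- `gFun` unfolds as stated. [cite: HanrotEtAl2007, §4.1] -/
theorem gFun_apply (f : ℝ → ℝ) (μ : ℝ) (r : ℤ) (x : ℝ) : gFun f μ r x = f (r * μ + x) := rfl

/-- **The key identity** [cite: HanrotEtAl2007, §4.1]: "consider an integer `q` such that `τ := qμ cmod Π` is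
small … `t = sq + r` … Then `μt` in Equation (1) becomes `τs + μr mod Π`", hence for `f` of period `Π`,
`f(μt) = f(μqs + μr) = f(τs + μr) = g_r(τs)`. Stated for ANY `τ ≡ qμ (mod Π)`, i.e. `τ = qμ − ℓΠ` with `ℓ ∈ ℤ`
(the paper's `cmod` choice `ℓ = round (qμ/Π)` makes `|τ| ⩽ Π/2`; a convergent denominator `q` makes it tiny). -/
theorem apply_mul_eq_gFun (hf : Function.Periodic f P) (hτ : τ = q * μ - ℓ * P) (s r : ℤ) :
    f (μ * ((s * q + r : ℤ) : ℝ)) = gFun f μ r (τ * s) := by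
  rw [gFun_apply]
  have e : μ * ((s * q + r : ℤ) : ℝ) = (r * μ + τ * s) + ((s * ℓ : ℤ) : ℝ) * P := by
    rw [hτ]; push_cast; ring
  rw [e]
  exact (hf.int_mul (s * ℓ)) _

/-- **Equation (1) transforms progression by progression** [cite: HanrotEtAl2007, §4.1]: `t = sq + r` is a
solution of `|λ·f(μt) cmod 1| ⩽ ε` iff `s` is a solution of "`|λ · g_r(τs) cmod 1| ⩽ ε`" — "one problem for the
function `f` with parameters `λ, μ, t₀, N`" becomes "`q` similar problems for the functions `g_r`, `0 ⩽ r < q`,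
with parameters `λ, τ, (t₀ − r)/q, N/q`". -/
theorem eqOne_iff_eqOne_gFun (hf : Function.Periodic f P) (hτ : τ = q * μ - ℓ * P) (lam ε : ℝ) (s r : ℤ) :
    EqOne f lam μ ε (s * q + r) ↔ EqOne (gFun f μ r) lam τ ε s := by
  unfold EqOne
  rw [apply_mul_eq_gFun hf hτ s r]

/-- "Each `t ∈ ⟦t₀, t₀ + N⟧` can be uniquely written `t = sq + r`, where `0 ⩽ r < q`" — existence
(`s = ⌊t/q⌋`, `r = t mod q`). [cite: HanrotEtAl2007, §4.1] -/
theorem exists_eq_mul_add_of_pos (hq : 0 < q) (t : ℤ) :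
    ∃ s r : ℤ, 0 ≤ r ∧ r < q ∧ t = s * q + r := by
  have hq' : (0 : ℤ) < q := by exact_mod_cast hq
  exact ⟨t / q, t % q, Int.emod_nonneg _ hq'.ne', Int.emod_lt_of_pos _ hq', (Int.ediv_mul_add_emod t q).symm⟩

/-- … and uniqueness. [cite: HanrotEtAl2007, §4.1] -/
theorem mul_add_inj_of_lt {s s' r r' : ℤ} (hr : 0 ≤ r) (hrq : r < q) (hr' : 0 ≤ r') (hrq' : r' < q)
    (h : s * q + r = s' * q + r') : s = s' ∧ r = r' := by
  have hq' : (0 : ℤ) < q := by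
    have : (0 : ℤ) ≤ r := hr
    omega
  have hs : s = (s * q + r) / q := by
    rw [add_comm, Int.add_mul_ediv_right _ _ hq'.ne', Int.ediv_eq_zero_of_lt hr hrq, zero_add]
  have hs' : s' = (s' * q + r') / q := by
    rw [add_comm, Int.add_mul_ediv_right _ _ hq'.ne', Int.ediv_eq_zero_of_lt hr' hrq', zero_add]
  have hss : s = s' := by rw [hs, hs', h]
  refine ⟨hss, ?_⟩
  rw [hss] at h
  linarith

/-- The range of the progression index: `sq + r ∈ ⟦t₀, t₀ + N⟧` iff
"`s ∈ ⟦(t₀ − r)/q, (t₀ + N − r)/q⟧`", i.e. `⌈(t₀ − r)/q⌉ ⩽ s ⩽ ⌊(t₀ + N − r)/q⌋`.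
[cite: HanrotEtAl2007, §4.1] -/
theorem mul_add_mem_Icc_iff (hq : 0 < q) (s r t₀ N : ℤ) :
    (t₀ ≤ s * q + r ∧ s * q + r ≤ t₀ + N) ↔
      ⌈((t₀ - r : ℤ) : ℚ) / q⌉ ≤ s ∧ s ≤ ⌊((t₀ + N - r : ℤ) : ℚ) / q⌋ := by
  have hq' : (0 : ℚ) < q := by exact_mod_cast hq
  rw [Int.ceil_le, Int.le_floor, div_le_iff₀ hq', le_div_iff₀ hq']
  push_cast
  constructor
  · rintro ⟨h1, h2⟩
    exact ⟨by exact_mod_cast (show t₀ - r ≤ s * q by linarith), by exact_mod_cast (show s * q ≤ t₀ + N - r by linarith)⟩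
  · rintro ⟨h1, h2⟩
    have h1' : t₀ - r ≤ s * (q : ℤ) := by exact_mod_cast h1
    have h2' : s * (q : ℤ) ≤ t₀ + N - r := by exact_mod_cast h2
    exact ⟨by linarith, by linarith⟩

/-- Two indices of the same progression inside `⟦t₀, t₀ + N⟧` differ by at most `⌊N/q⌋`: the progression
`A(q, r)` meets the range in at most `⌊N/q⌋ + 1` points (the `N/q` of "parameters `λ, τ, (t₀ − r)/q, N/q`";
§6.1: "each arithmetic progression `sq + r` for a given `r` has at most 298116 elements in the range
`[2^52, 2^53)`", `q = 15106909301`). [cite: HanrotEtAl2007, §4.1 and §6.1] -/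
theorem sub_le_ediv_of_mem_progression (hq : 0 < q) {s₁ s₂ r t₀ N : ℤ} (h₁ : t₀ ≤ s₁ * q + r)
    (h₂ : s₂ * q + r ≤ t₀ + N) : s₂ - s₁ ≤ N / q := by
  have hq' : (0 : ℤ) < q := by exact_mod_cast hq
  have h : (s₂ - s₁) * q ≤ N := by nlinarith
  exact Int.le_ediv_of_mul_le hq' h

/-- §6.1's count for the largest binade (`t ∈ ⟦2^52, 2^53 − 1⟧`, so `N = 2^52 − 1`, `q = 15106909301`):
`⌊N/q⌋ + 1 = 298116` — "at most 298116 elements", "the maximal value of `T′` … is about 149058".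
[cite: HanrotEtAl2007, §6.1] -/
example : ((2 : ℤ) ^ 52 - 1) / 15106909301 + 1 = 298116 ∧ (298116 : ℤ) / 2 = 149058 := by norm_num

/-- **Completeness of the reduction (Figure 3 / Theorem 1, "finds all the values")**
[cite: HanrotEtAl2007, §4.1, Figure 3 and Theorem 1]: "Writing `x₀ = t₀μ` and `x_N = (t₀ + N)μ`, we then
decompose the interval `⟦t₀, t₀ + N⟧μ` as `[x₀, x_N] = ⋃_{r=0}^{q−1} μ · A(q, r)` where `A(q, r)` is the part of the
arithmetic progression `r mod q` which is within the interval `[t₀, t₀ + N]`" — so the solution set of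
Equation (1) is the union over `r < q` of the images `s ↦ sq + r` of the solution sets of the reduced equations
`|λ·g_r(τs) cmod 1| ⩽ ε` over the admissible indices `s`. (Each reduced set is what Step 4 of Figure 3 asks the SLZ
algorithm — or Lefèvre's — to return.) -/
theorem solutions_eq_biUnion (hf : Function.Periodic f P) (hτ : τ = q * μ - ℓ * P) (hq : 0 < q)
    (lam ε : ℝ) (t₀ N : ℤ) :
    solutions f lam μ ε t₀ N =
      ⋃ r ∈ Finset.range q, (fun s : ℤ => s * q + r) ''
        {s : ℤ | t₀ ≤ s * q + r ∧ s * q + r ≤ t₀ + N ∧ EqOne (gFun f μ r) lam τ ε s} := by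
  ext t
  simp only [mem_solutions_iff, mem_iUnion, mem_image, mem_setOf_eq, Finset.mem_range, exists_prop]
  constructor
  · rintro ⟨h1, h2, h3⟩
    obtain ⟨s, r, hr0, hrq, rfl⟩ := exists_eq_mul_add_of_pos hq t
    refine ⟨r.toNat, by omega, s, ⟨?_, ?_, ?_⟩, ?_⟩
    · rwa [Int.toNat_of_nonneg hr0]
    · rwa [Int.toNat_of_nonneg hr0]
    · rw [Int.toNat_of_nonneg hr0]; exact (eqOne_iff_eqOne_gFun hf hτ lam ε s r).1 h3
    · rw [Int.toNat_of_nonneg hr0]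
  · rintro ⟨r, _, s, ⟨h1, h2, h3⟩, rfl⟩
    exact ⟨h1, h2, (eqOne_iff_eqOne_gFun hf hτ lam ε s r).2 h3⟩

/-- **How the `q` progressions reassemble the range** (the partition `[x₀, x_N] = ⋃_{r<q} μ·A(q, r)` read as a
covering principle): a property established for every admissible index of every progression `r mod q`,
`0 ⩽ r < q`, holds for every `t ∈ ⟦t₀, t₀ + N⟧` — this is how per-progression certificates close a binade
statement ([BrisebarreEtAl2025] Problem 4.1 over `⟦2^(p−1), 2^p − 1⟧`). [cite: HanrotEtAl2007, §4.1 and Figure 3] -/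
theorem forall_Icc_of_forall_progression (hq : 0 < q) {Q : ℤ → Prop} {t₀ N : ℤ}
    (h : ∀ r : ℤ, 0 ≤ r → r < q → ∀ s : ℤ, t₀ ≤ s * q + r → s * q + r ≤ t₀ + N → Q (s * q + r)) :
    ∀ t : ℤ, t₀ ≤ t → t ≤ t₀ + N → Q t := by
  intro t h1 h2
  obtain ⟨s, r, hr0, hrq, rfl⟩ := exists_eq_mul_add_of_pos hq t
  exact h r hr0 hrq s h1 h2

end Reduction

/-! ## §4.1 in the Table-Maker's-Dilemma vocabulary, and the Lefèvre route along a progression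

"We are thus back to the classical case, where Lefèvre's or the SLZ algorithms apply. One difference is that the
distance between two consecutive numbers to check is `τ` which is irrational instead of `2^(e−p)`, but this makes
no difference for Lefèvre's algorithm or SLZ. Following the principle of worst cases algorithms, we might have to
split our 'intervals' `I_r` into smaller 'sub-intervals': in that case, we split each arithmetic progression
`A(q, r)` into sub-progressions" [HanrotEtAl2007, §4.1]. Below, a sub-progression is `(s₀ + k)·q + r`, `k < N`.
-/

section TMD

variable {f : ℝ → ℝ} {P τ : ℝ} {p : ℕ} {e₁ e₂ : ℤ} {q : ℕ} {ℓ : ℤ}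

/-- **The reduction for the scaled function of [BrisebarreEtAl2025] Problem 4.1**: for `f` of period `Π` and
`τ = q·2^(e₁−p+1) − ℓΠ`, the scaled value at the significand `s·q + r` is `2^(p−1−e₂)·f(r·2^(e₁−p+1) + τ·s)` — a
smooth function of `s` sampled on an arithmetic progression of step `τ`.
[cite: HanrotEtAl2007, §4.1; BrisebarreEtAl2025, Problem 4.1] -/
theorem scaled_mul_add (hf : Function.Periodic f P) (hτ : τ = q * (2 : ℝ) ^ (e₁ - (p : ℤ) + 1) - ℓ * P)
    (s r : ℤ) :
    scaled f p e₁ e₂ (s * q + r) =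
      (2 : ℝ) ^ ((p : ℤ) - 1 - e₂) * f (r * (2 : ℝ) ^ (e₁ - (p : ℤ) + 1) + τ * s) := by
  rw [scaled_eq_lam_mul, apply_mul_eq_gFun hf hτ s r, gFun_apply]

/-- The paper's running example in tree vocabulary: "`sin x` in `[2^1023, 2^1024)`, which corresponds to the
largest binade of the IEEE-754 double precision. The difference between two consecutive machine numbers in that
binade is `μ = 2^971`" — `p = 53`, `e₁ = 1023`, period `2π`; for any `q` and `ℓ` (the paper: `q = 15106909301`, a
convergent denominator of `μ/(2π)`, `τ = qμ cmod 2π ≈ 0.441·10⁻¹²`) and any output binade `e₂`: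
`scaled sin 53 1023 e₂ (s·q + r) = 2^(52−e₂)·sin(r·2^971 + τ·s)`. [cite: HanrotEtAl2007, §2 Example and §6.1] -/
example {τ : ℝ} {q : ℕ} {ℓ : ℤ} (hτ : τ = q * (2 : ℝ) ^ (971 : ℤ) - ℓ * (2 * Real.pi)) (e₂ s r : ℤ) :
    scaled Real.sin 53 1023 e₂ (s * q + r) = (2 : ℝ) ^ ((52 : ℤ) - e₂) * Real.sin (r * (2 : ℝ) ^ (971 : ℤ) + τ * s) := by
  have h := scaled_mul_add (f := Real.sin) (p := 53) (e₁ := 1023) (e₂ := e₂) Real.sin_periodic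
    (by norm_num; exact hτ) s r
  rw [h]; norm_num

variable {m N : ℕ} {s₀ r : ℤ}

/-- **Sub-progression elimination, directed roundings** (Lefèvre's test run along the progression): if the
reduced scaled values `2^(p−1−e₂)·f(rμ + τ(s₀ + k))`, `k < N`, are within `δ` of a segment `b − k·a`,
`2^(−m) + δ ⩽ w`, and `N ⩽ algorithm1 a (b + w) (2w) N` ([Lefevre2005] Algorithm 1 finds no point), then no
significand `(s₀ + k)·q + r`, `k < N`, is an `m`-bad case for the directed roundings.
[cite: HanrotEtAl2007, §4.1; Lefevre2005, §2.1 and Algorithm 1; BrisebarreEtAl2025, Problem 4.1] -/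
theorem not_isBadCaseDir_progression_of_algorithm1 {a b δ w : ℝ}
    (hf : Function.Periodic f P) (hτ : τ = q * (2 : ℝ) ^ (e₁ - (p : ℤ) + 1) - ℓ * P)
    (happrox : ∀ k : ℕ, k < N →
      |(2 : ℝ) ^ ((p : ℤ) - 1 - e₂) * f (r * (2 : ℝ) ^ (e₁ - (p : ℤ) + 1) + τ * ((s₀ : ℝ) + k)) - (b - k * a)| ≤ δ)
    (hw : (2 : ℝ) ^ (-(m : ℤ)) + δ ≤ w) (halg : N ≤ algorithm1 a (b + w) (2 * w) N) :
    ∀ k : ℕ, k < N → ¬ IsBadCaseDir m (scaled f p e₁ e₂ ((s₀ + k) * q + r)) := by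
  intro k hk
  rw [not_isBadCaseDir_iff]
  intro n
  have h := le_abs_sub_int_of_algorithm1
    (g := fun k : ℕ => (2 : ℝ) ^ ((p : ℤ) - 1 - e₂) * f (r * (2 : ℝ) ^ (e₁ - (p : ℤ) + 1) + τ * ((s₀ : ℝ) + k)))
    happrox hw halg k hk n
  rwa [scaled_mul_add hf hτ, Int.cast_add, Int.cast_natCast]

/-- **Sub-progression elimination, rounding to nearest**: the same with the segment shifted by `−1/2`.
[cite: HanrotEtAl2007, §4.1; Lefevre2005, §2.1 and Algorithm 1; BrisebarreEtAl2025, Problem 4.2] -/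
theorem not_isBadCaseRN_progression_of_algorithm1 {a b δ w : ℝ}
    (hf : Function.Periodic f P) (hτ : τ = q * (2 : ℝ) ^ (e₁ - (p : ℤ) + 1) - ℓ * P)
    (happrox : ∀ k : ℕ, k < N →
      |(2 : ℝ) ^ ((p : ℤ) - 1 - e₂) * f (r * (2 : ℝ) ^ (e₁ - (p : ℤ) + 1) + τ * ((s₀ : ℝ) + k)) - (b - k * a)| ≤ δ)
    (hw : (2 : ℝ) ^ (-(m : ℤ)) + δ ≤ w) (halg : N ≤ algorithm1 a (b - 1 / 2 + w) (2 * w) N) :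
    ∀ k : ℕ, k < N → ¬ IsBadCaseRN m (scaled f p e₁ e₂ ((s₀ + k) * q + r)) := by
  intro k hk
  rw [not_isBadCaseRN_iff]
  intro n
  set g : ℕ → ℝ :=
    fun k : ℕ => (2 : ℝ) ^ ((p : ℤ) - 1 - e₂) * f (r * (2 : ℝ) ^ (e₁ - (p : ℤ) + 1) + τ * ((s₀ : ℝ) + k)) with hg
  have happrox' : ∀ k : ℕ, k < N → |(g k - 1 / 2) - ((b - 1 / 2) - k * a)| ≤ δ := fun k hk => by
    rw [show (g k - 1 / 2) - ((b - 1 / 2) - k * a) = g k - (b - k * a) by ring]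
    exact happrox k hk
  have h := le_abs_sub_int_of_algorithm1 (g := fun k : ℕ => g k - 1 / 2) happrox' hw halg k hk n
  have hgk : g k = scaled f p e₁ e₂ ((s₀ + k) * q + r) := by
    rw [hg, scaled_mul_add hf hτ, Int.cast_add, Int.cast_natCast]
  rw [← hgk, show g k - (↑n + 1 / 2) = g k - 1 / 2 - n by ring]
  exact h

/-- Directed roundings with the test DECIDED OVER `ℚ` (rational segment data `a, b` and half-width `w`; the
`algorithm1` hypothesis is a closed rational computation, `decide +kernel`, transported to `ℝ` by
`Lefevre2005.le_algorithm1_ratCast_iff`). [cite: HanrotEtAl2007, §4.1; Lefevre2005, §2.1 and Algorithm 1] -/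
theorem not_isBadCaseDir_progression_of_algorithm1_rat {a b w : ℚ} {δ : ℝ}
    (hf : Function.Periodic f P) (hτ : τ = q * (2 : ℝ) ^ (e₁ - (p : ℤ) + 1) - ℓ * P)
    (happrox : ∀ k : ℕ, k < N →
      |(2 : ℝ) ^ ((p : ℤ) - 1 - e₂) * f (r * (2 : ℝ) ^ (e₁ - (p : ℤ) + 1) + τ * ((s₀ : ℝ) + k))
        - ((b : ℝ) - k * (a : ℝ))| ≤ δ)
    (hw : (2 : ℝ) ^ (-(m : ℤ)) + δ ≤ (w : ℝ)) (halg : N ≤ algorithm1 a (b + w) (2 * w) N) :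
    ∀ k : ℕ, k < N → ¬ IsBadCaseDir m (scaled f p e₁ e₂ ((s₀ + k) * q + r)) := by
  have halg' : N ≤ algorithm1 ((a : ℚ) : ℝ) (((b + w : ℚ)) : ℝ) (((2 * w : ℚ)) : ℝ) N :=
    (le_algorithm1_ratCast_iff (K := ℝ) a (b + w) (2 * w) N).2 halg
  push_cast at halg'
  exact not_isBadCaseDir_progression_of_algorithm1 hf hτ happrox hw halg'

/-- Rounding to nearest with the test decided over `ℚ` (segment shifted by `−1/2`).
[cite: HanrotEtAl2007, §4.1; Lefevre2005, §2.1 and Algorithm 1] -/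
theorem not_isBadCaseRN_progression_of_algorithm1_rat {a b w : ℚ} {δ : ℝ}
    (hf : Function.Periodic f P) (hτ : τ = q * (2 : ℝ) ^ (e₁ - (p : ℤ) + 1) - ℓ * P)
    (happrox : ∀ k : ℕ, k < N →
      |(2 : ℝ) ^ ((p : ℤ) - 1 - e₂) * f (r * (2 : ℝ) ^ (e₁ - (p : ℤ) + 1) + τ * ((s₀ : ℝ) + k))
        - ((b : ℝ) - k * (a : ℝ))| ≤ δ)
    (hw : (2 : ℝ) ^ (-(m : ℤ)) + δ ≤ (w : ℝ)) (halg : N ≤ algorithm1 a (b - 1 / 2 + w) (2 * w) N) :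
    ∀ k : ℕ, k < N → ¬ IsBadCaseRN m (scaled f p e₁ e₂ ((s₀ + k) * q + r)) := by
  have halg' : N ≤ algorithm1 ((a : ℚ) : ℝ) (((b - 1 / 2 + w : ℚ)) : ℝ) (((2 * w : ℚ)) : ℝ) N :=
    (le_algorithm1_ratCast_iff (K := ℝ) a (b - 1 / 2 + w) (2 * w) N).2 halg
  push_cast at halg'
  exact not_isBadCaseRN_progression_of_algorithm1 hf hτ happrox hw halg'

end TMD

/-! ## The approximation hypothesis along a progression (degree `d = 1`)

§4.1: "The point is now that, `τs` being small over this latter interval, if `f` is regular enough,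
`f(τs + μr)` can rightfully be approximated by the Taylor polynomial `f(μr) + τs·f′(μr) + Σ_{k=2}^{d} (τs)^k
f^(k)(μr)/k!`, with an error of the order of `(τs)^(d+1)`." For the Lefèvre route (`d = 1`) the error of the
segment over a sub-progression of `N` points is `⩽ C·τ²·M·N²/2` when `|f″| ⩽ M` (`C = 2^(p−1−e₂)`), exactly as in
`Lefevre2005.approx_of_second_deriv_bound` with the grid step `1` replaced by `τ`.
-/

section Approximation

/-- Derivative of `x ↦ C·f(c + τx)` (chain rule with the affine reparametrisation of the progression).
[cite: HanrotEtAl2007, §4.1] -/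
theorem hasDerivAt_const_mul_comp_affine {f f' : ℝ → ℝ} {C c τ x : ℝ}
    (hf : HasDerivAt f (f' (c + τ * x)) (c + τ * x)) :
    HasDerivAt (fun y : ℝ => C * f (c + τ * y)) (C * τ * f' (c + τ * x)) x := by
  have hlin : HasDerivAt (fun y : ℝ => c + τ * y) τ x := by
    simpa using ((hasDerivAt_id x).const_mul τ).const_add c
  have h := (hf.comp x hlin).const_mul C
  refine h.congr_deriv ?_
  ring

/-- **The piece hypothesis along a progression from a bound on `f″`.** If `|f″| ⩽ M` at the reduced arguments
`c + τx`, `x ∈ [s₀, s₀ + N]`, and the segment data `b, a` are within `η₀, η₁` of `C·f(c + τs₀)` and of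
`−C·τ·f′(c + τs₀)` (Lefèvre's sign convention `b − k·a`), then
`|C·f(c + τ(s₀ + k)) − (b − k·a)| ⩽ δ` for all `k < N` as soon as `η₀ + N·η₁ + C·τ²·M·N²/2 ⩽ δ` (`C ⩾ 0`).
With `C = 2^(p−1−e₂)`, `c = r·2^(e₁−p+1)` this is the hypothesis `happrox` of
`not_isBadCaseDir_progression_of_algorithm1`. [cite: HanrotEtAl2007, §4.1; Lefevre2005, §2.1] -/
theorem approx_progression_of_second_deriv_bound {f f' f'' : ℝ → ℝ} {C c τ : ℝ} {s₀ : ℤ} {N : ℕ}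
    {a b M η₀ η₁ δ : ℝ}
    (hf : ∀ x ∈ Icc (s₀ : ℝ) (s₀ + N), HasDerivAt f (f' (c + τ * x)) (c + τ * x))
    (hf' : ∀ x ∈ Icc (s₀ : ℝ) (s₀ + N), HasDerivAt f' (f'' (c + τ * x)) (c + τ * x))
    (hM : ∀ x ∈ Icc (s₀ : ℝ) (s₀ + N), |f'' (c + τ * x)| ≤ M) (hC : 0 ≤ C)
    (hb : |C * f (c + τ * s₀) - b| ≤ η₀) (ha : |C * τ * f' (c + τ * s₀) + a| ≤ η₁)
    (hδ : η₀ + N * η₁ + C * τ ^ 2 * M * (N : ℝ) ^ 2 / 2 ≤ δ) :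
    ∀ k : ℕ, k < N → |C * f (c + τ * ((s₀ : ℝ) + k)) - (b - k * a)| ≤ δ := by
  let g : ℝ → ℝ := fun y => C * f (c + τ * y)
  let g' : ℝ → ℝ := fun y => C * τ * f' (c + τ * y)
  let g'' : ℝ → ℝ := fun y => C * τ * τ * f'' (c + τ * y)
  have hg : ∀ y ∈ Icc (s₀ : ℝ) (s₀ + N), HasDerivAt g (g' y) y :=
    fun y hy => hasDerivAt_const_mul_comp_affine (hf y hy)
  have hg' : ∀ y ∈ Icc (s₀ : ℝ) (s₀ + N), HasDerivAt g' (g'' y) y := by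
    intro y hy
    have h := hasDerivAt_const_mul_comp_affine (C := C * τ) (hf' y hy)
    exact h
  have hMg : ∀ y ∈ Icc (s₀ : ℝ) (s₀ + N), |g'' y| ≤ C * τ ^ 2 * M := by
    intro y hy
    show |C * τ * τ * f'' (c + τ * y)| ≤ C * τ ^ 2 * M
    rw [show C * τ * τ = C * τ ^ 2 by ring, abs_mul, abs_of_nonneg (by positivity : 0 ≤ C * τ ^ 2)]
    exact mul_le_mul_of_nonneg_left (hM y hy) (by positivity)
  have hb' : |g (s₀ : ℝ) - b| ≤ η₀ := hb
  have ha' : |g' (s₀ : ℝ) + a| ≤ η₁ := ha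
  have hδ' : η₀ + N * η₁ + C * τ ^ 2 * M * (N : ℝ) ^ 2 / 2 ≤ δ := hδ
  intro k hk
  exact approx_of_second_deriv_bound hg hg' hMg hb' ha' hδ' k hk

/-- The `sin` instance (`f′ = cos`, `f″ = −sin`, `M = 1`: "since the function is `C^∞` and periodic, its
successive derivatives are uniformly bounded", §2). [cite: HanrotEtAl2007, §2 and §4.1] -/
theorem approx_progression_sin {C c τ : ℝ} {s₀ : ℤ} {N : ℕ} {a b η₀ η₁ δ : ℝ} (hC : 0 ≤ C)
    (hb : |C * Real.sin (c + τ * s₀) - b| ≤ η₀) (ha : |C * τ * Real.cos (c + τ * s₀) + a| ≤ η₁)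
    (hδ : η₀ + N * η₁ + C * τ ^ 2 * (N : ℝ) ^ 2 / 2 ≤ δ) :
    ∀ k : ℕ, k < N → |C * Real.sin (c + τ * ((s₀ : ℝ) + k)) - (b - k * a)| ≤ δ :=
  approx_progression_of_second_deriv_bound (f' := Real.cos) (f'' := fun x => -Real.sin x) (M := 1)
    (fun y _ => Real.hasDerivAt_sin _) (fun y _ => Real.hasDerivAt_cos _)
    (fun y _ => by simpa using Real.abs_sin_le_one (c + τ * y)) hC hb ha (by simpa using hδ)

/-- The `cos` instance (`f′ = −sin`, `f″ = −cos`, `M = 1`). [cite: HanrotEtAl2007, §2 and §4.1] -/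
theorem approx_progression_cos {C c τ : ℝ} {s₀ : ℤ} {N : ℕ} {a b η₀ η₁ δ : ℝ} (hC : 0 ≤ C)
    (hb : |C * Real.cos (c + τ * s₀) - b| ≤ η₀) (ha : |-(C * τ * Real.sin (c + τ * s₀)) + a| ≤ η₁)
    (hδ : η₀ + N * η₁ + C * τ ^ 2 * (N : ℝ) ^ 2 / 2 ≤ δ) :
    ∀ k : ℕ, k < N → |C * Real.cos (c + τ * ((s₀ : ℝ) + k)) - (b - k * a)| ≤ δ :=
  approx_progression_of_second_deriv_bound (f' := fun x => -Real.sin x) (f'' := fun x => -Real.cos x) (M := 1)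
    (fun y _ => Real.hasDerivAt_cos _) (fun y _ => (Real.hasDerivAt_sin _).neg)
    (fun y _ => by simpa using Real.abs_cos_le_one (c + τ * y)) hC hb (by simpa using ha) (by simpa using hδ)

end Approximation

/-! ## §4.3 Computing the output exponents

"An additional problem is to compute the output exponent … for a given subset `{(sq + r)μ, t₀ ⩽ sq + r ⩽ t₀ + N}`,
and to check that exponent is constant on that subset. … The arguments in the reduced subset are thus all in the
interval `[x₀, x₀ + h]` with `h = τ⌈N/q⌉`. … For the sine function, this check is easy: it suffices to check that
`sin x₀` and `sin(x₀ + h)` lie in the same binade. Indeed, the sine function is decreasing on `[−π, −π/2]`,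
increasing on `[−π/2, π/2]`, and then decreasing on `[π/2, π]`. Around the points `−π/2` and `π/2` where the
derivative sign changes, one has `1/2 ⩽ |sin x| ⩽ 1` in an interval of width `2π/3 > h`." [HanrotEtAl2007, §4.3]
-/

section Exponent

/-- On a monotonicity interval the binade of `g` is read off the two end values: `L ⩽ g(lo)` and `g(hi) < U`
give `L ⩽ g y < U` on `[lo, hi]` ("it suffices to check that `sin x₀` and `sin(x₀ + h)` lie in the same
binade"). [cite: HanrotEtAl2007, §4.3] -/
theorem mem_Ico_of_monotoneOn {g : ℝ → ℝ} {lo hi L U : ℝ} (hg : MonotoneOn g (Icc lo hi))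
    (hlo : L ≤ g lo) (hhi : g hi < U) : ∀ y ∈ Icc lo hi, L ≤ g y ∧ g y < U := by
  intro y hy
  have h1 : lo ≤ hi := hy.1.trans hy.2
  exact ⟨hlo.trans (hg (left_mem_Icc.2 h1) hy hy.1), (hg hy (right_mem_Icc.2 h1) hy.2).trans_lt hhi⟩

/-- The antitone version (e.g. `sin` on `[π/2, π]`, `cos` on `[0, π]`). [cite: HanrotEtAl2007, §4.3] -/
theorem mem_Ico_of_antitoneOn {g : ℝ → ℝ} {lo hi L U : ℝ} (hg : AntitoneOn g (Icc lo hi))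
    (hhi : L ≤ g hi) (hlo : g lo < U) : ∀ y ∈ Icc lo hi, L ≤ g y ∧ g y < U := by
  intro y hy
  have h1 : lo ≤ hi := hy.1.trans hy.2
  exact ⟨hhi.trans (hg hy (right_mem_Icc.2 h1) hy.2), (hg (left_mem_Icc.2 h1) hy hy.1).trans_lt hlo⟩

/-- "Around the points `−π/2` and `π/2` … one has `1/2 ⩽ |sin x| ⩽ 1` in an interval of width `2π/3`": on
`[π/6, 5π/6]`, `1/2 ⩽ sin x`. [cite: HanrotEtAl2007, §4.3] -/
theorem half_le_sin_of_mem_Icc {x : ℝ} (h₁ : Real.pi / 6 ≤ x) (h₂ : x ≤ 5 * Real.pi / 6) :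
    1 / 2 ≤ Real.sin x := by
  have hpi := Real.pi_pos
  by_cases hx : x ≤ Real.pi / 2
  · rw [← Real.sin_pi_div_six]
    exact Real.strictMonoOn_sin.monotoneOn ⟨by linarith, by linarith⟩ ⟨by linarith, hx⟩ h₁
  · push Not at hx
    rw [← Real.sin_pi_sub, ← Real.sin_pi_div_six]
    exact Real.strictMonoOn_sin.monotoneOn ⟨by linarith, by linarith⟩ ⟨by linarith, by linarith⟩ (by linarith)

/-- The symmetric band: on `[−5π/6, −π/6]`, `sin x ⩽ −1/2`. [cite: HanrotEtAl2007, §4.3] -/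
theorem sin_le_neg_half_of_mem_Icc {x : ℝ} (h₁ : -(5 * Real.pi / 6) ≤ x) (h₂ : x ≤ -(Real.pi / 6)) :
    Real.sin x ≤ -(1 / 2) := by
  have h := half_le_sin_of_mem_Icc (x := -x) (by linarith) (by linarith)
  rw [Real.sin_neg] at h
  linarith

/-- A floating-point (indeed any nonzero rational) argument never attains `|sin x| = 1` (that would make `π`
rational), so after the band check the top output binade of `sin` is `[1/2, 1)`, never `[1, 2)`.
[cite: HanrotEtAl2007, §4.3] -/
theorem abs_sin_ratCast_lt_one (x : ℚ) : |Real.sin x| < 1 := by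
  rcases (Real.abs_sin_le_one x).lt_or_eq with h | h
  · exact h
  · exfalso
    have hcos : Real.cos x = 0 := by
      have := Real.sin_sq_add_cos_sq (x : ℝ)
      rw [← sq_abs, h] at this
      nlinarith
    obtain ⟨k, hk⟩ := Real.cos_eq_zero_iff.1 hcos
    have hk0 : (2 * (k : ℝ) + 1) ≠ 0 := by
      have : (2 * (k : ℝ) + 1) = ((2 * k + 1 : ℤ) : ℝ) := by push_cast; ring
      rw [this]; exact_mod_cast (by omega : (2 * k + 1 : ℤ) ≠ 0)
    have hpi : Real.pi = 2 * (x : ℝ) / (2 * k + 1) := by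
      field_simp
      linarith
    apply irrational_pi
    refine ⟨2 * x / (2 * k + 1 : ℚ), ?_⟩
    rw [hpi]; push_cast; ring

end Exponent

/-! ## §5: a good multiplier `q ⩽ Q` always exists (Dirichlet) -/

/-- "Note that, by the classical Dirichlet theorem, for any `Q` one can find `0 ⩽ q ⩽ Q` such that the
corresponding `τ` has `|τ| ⩽ Π/Q = O(1/Q)`": for `Π > 0` and `Q ⩾ 1` there are `1 ⩽ q ⩽ Q` and `ℓ ∈ ℤ` with
`|qμ − ℓΠ| ⩽ Π/(Q + 1)` (from Mathlib's `Real.exists_int_int_abs_mul_sub_le` applied to `μ/Π`). The paper takes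
`q` = the largest continued-fraction convergent denominator `⩽ Q` of `μ/Π` (Figure 3, Step 1), which satisfies a
bound of the same shape. [cite: HanrotEtAl2007, §5 and Figure 3 Step 1] -/
theorem exists_mul_sub_int_mul_le {P : ℝ} (hP : 0 < P) (μ : ℝ) {Q : ℕ} (hQ : 0 < Q) :
    ∃ q : ℕ, 0 < q ∧ q ≤ Q ∧ ∃ ℓ : ℤ, |(q : ℝ) * μ - ℓ * P| ≤ P / (Q + 1) := by
  obtain ⟨j, k, hk0, hkQ, h⟩ := Real.exists_int_int_abs_mul_sub_le (μ / P) hQ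
  refine ⟨k.toNat, by omega, by omega, j, ?_⟩
  have hk : ((k.toNat : ℕ) : ℝ) = (k : ℝ) := by exact_mod_cast Int.toNat_of_nonneg hk0.le
  have e : ((k.toNat : ℕ) : ℝ) * μ - j * P = P * (k * (μ / P) - j) := by
    rw [hk]; field_simp
  rw [e, abs_mul, abs_of_pos hP, mul_comm]
  calc |↑k * (μ / P) - ↑j| * P ≤ 1 / (Q + 1) * P := mul_le_mul_of_nonneg_right h hP.le
    _ = P / (Q + 1) := by ring

end Literature.ComputerArithmetic.HanrotLefevreStehleZimmermann2007
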